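import Mathlib
import Summits.BirchSwinnertonDyer.BirchSwinnertonDyer.Theorems.KatoDescentTamePotSupersingularTameLowerFibreAdjointBricksFiveLocalRingDet

/-!
# Bricks for the `GL₂(𝔽₅)`-lifting route (T5′), XIII: arbitrary residue field (`f ≥ 1`) — reduction to
# `f = 1` through the subring of prime-field residues

Continuation of file XII (`…AdjointBricksFiveLocalRingDet`, same namespace). Files IX–XII prove (T5′) at every
finite level for finite local rings with residue field EXACTLY `𝔽₅`. In Δ1 proper the coefficient rings
`𝒪_𝔭` have residue field `𝔽_{5^f}` with any `f ≥ 1`; but the residual representation is `ρ̄_W ⊗ 𝔽_{5^f}`,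
so the residual image of `G` is the image of `GL₂(𝔽₅)` in `GL₂(𝔽_{5^f})` — every element of `G` has
residues in the PRIME FIELD. This file turns that remark into the general finite-level theorem: for `A`
finite of characteristic `5^{m+1}` with a residue map `res : A → k` to ANY ring of characteristic `5`
(every `a` whose residue is a non-zero element of the prime field being a unit), a subgroup `H ≤ GL₂(A)`
whose reduction covers the image of `GL₂(𝔽₅)` contains `u · S^μ(ℤ/5^{m+1}) · u⁻¹` with `res(u) = 1`.
Proof: `H' = H ∩ res⁻¹(GL₂(𝔽₅))` lives in `GL₂(A₀)`, `A₀ = res⁻¹(𝔽₅) ⊂ A` the subring of prime-field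
residues — a finite ring of the same characteristic with residue map `A₀ → 𝔽₅` of the file-XII kind — and
file XII applies to it.

* `exists_conj_smu_le_of_residual_GL2_charP` / `exists_conj_SL2_le_of_residual_GL2_charP` — **(T5′) at
  every finite level of every finite local ring of residue characteristic `5` (any `e`, any `f`), for
  residual image covering `GL₂(𝔽₅)`; in particular `u · SL₂(ℤ/5^{m+1}) · u⁻¹ ⊆ H`.**

After this file the (T5′)/(P′) dossier of ARM-P r07 S7 (Δ1@5, T-S7r07-1) is kernel at EVERY FINITE LEVEL of
EVERY Δ1 ring; what remains on paper is only (h), the passage to the limit `𝒪_𝔭 = lim 𝒪_𝔭/𝔭ⁿ` (closed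
subgroups; compactness of `GL₂(𝒪_𝔭)`). Route-free, no definitions, nothing about elliptic curves or items
19618/19981 (open). Target T-S7r07-1 (`FibreLatticeInput 5`).
-/

set_option linter.dupNamespace false

open Matrix

namespace Summit.BirchSwinnertonDyer.BirchSwinnertonDyer.Theorems.GL2F5AdjointBricks

section residuefield

universe u v

/-- **(T5′) at every finite level, arbitrary residue field (ARM-P r07 S7 ADD-1 §C (C0), finite-level form,
`f ≥ 1`).** Let `A` be a finite commutative ring of characteristic `5^{m+1}`, `k` a commutative ring of
characteristic `5`, `res : A → k` a ring map such that every `a ∈ A` whose residue is a non-zero element of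
the prime field `𝔽₅ ⊂ k` is a unit (e.g. `A` local with maximal ideal `ker res`, `k` its residue field
`𝔽_{5^f}`). Let `H ≤ GL₂(A)` be a subgroup whose reduction covers the image of `GL₂(𝔽₅)` in `GL₂(k)`. Then
`u · S^μ(ℤ/5^{m+1}) · u⁻¹ ⊆ H` for some `u ∈ GL₂(A)` with `res(u) = 1`. -/
theorem exists_conj_smu_le_of_residual_GL2_charP (A : Type u) [CommRing A] [Finite A]
    (k : Type v) [CommRing k] [CharP k 5] (res : A →+* k)
    (hloc : ∀ a : A, (∃ c : ZMod 5, c ≠ 0 ∧ res a = ZMod.castHom (dvd_refl 5) k c) → IsUnit a)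
    (m : ℕ) [CharP A (5 ^ (m + 1))] (H : Subgroup (GL (Fin 2) A))
    (hres : ∀ q : GL (Fin 2) (ZMod 5), ∃ h ∈ H, Matrix.GeneralLinearGroup.map res h =
      Matrix.GeneralLinearGroup.map (ZMod.castHom (dvd_refl 5) k) q) :
    ∃ u : GL (Fin 2) A, Matrix.GeneralLinearGroup.map res u = 1 ∧
      ∀ g : GL (Fin 2) (ZMod (5 ^ (m + 1))),
        Matrix.det (g : Matrix (Fin 2) (Fin 2) (ZMod (5 ^ (m + 1)))) ^ 4 = 1 →
          u * Matrix.GeneralLinearGroup.map (ZMod.castHom (dvd_refl (5 ^ (m + 1))) A) g * u⁻¹ ∈ H := by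
  classical
  haveI : Fact (Nat.Prime 5) := ⟨by norm_num⟩
  set ι5 := ZMod.castHom (dvd_refl 5) k with hι5
  have hι5inj : Function.Injective ι5 := ZMod.castHom_injective k
  set ρ := Matrix.GeneralLinearGroup.map (n := Fin 2) res with hρ
  set ιk := Matrix.GeneralLinearGroup.map (n := Fin 2) ι5 with hιk
  set ιA := Matrix.GeneralLinearGroup.map (n := Fin 2) (ZMod.castHom (dvd_refl (5 ^ (m + 1))) A) with hιA
  -- the subring of prime-field residues
  set A₀ : Subring A := (ι5.range).comap res with hA₀
  have hA₀mem : ∀ a, a ∈ A₀ ↔ ∃ c, ι5 c = res a := fun a => by rw [hA₀, Subring.mem_comap, RingHom.mem_range]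
  haveI : Finite A₀ := Subtype.finite
  haveI : CharP A₀ (5 ^ (m + 1)) := ⟨fun x => by
    rw [← CharP.cast_eq_zero_iff A (5 ^ (m + 1)) x, Subtype.ext_iff]; simp⟩
  -- its residue map to `𝔽₅`
  have hcod : ∀ a : A₀, (res.comp A₀.subtype) a ∈ ι5.range := fun a => (Subring.mem_comap.1 a.prop)
  set r₁ : A₀ →+* ι5.range := (res.comp A₀.subtype).codRestrict ι5.range hcod with hr₁
  have he_bij : Function.Bijective ι5.rangeRestrict :=
    ⟨fun x y hxy => hι5inj (congrArg Subtype.val hxy), RingHom.rangeRestrict_surjective ι5⟩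
  set e : ZMod 5 ≃+* ι5.range := RingEquiv.ofBijective ι5.rangeRestrict he_bij with he
  set res₀ : A₀ →+* ZMod 5 := e.symm.toRingHom.comp r₁ with hres₀
  have hι5e : ∀ y : ι5.range, ι5 (e.symm y) = y := by
    intro y
    have h : e (e.symm y) = y := e.apply_symm_apply y
    have h2 := congrArg Subtype.val h
    exact h2
  have hres₀ι : ∀ a : A₀, ι5 (res₀ a) = res a := by
    intro a
    show ι5 (e.symm (r₁ a)) = res a
    rw [hι5e]; rfl
  have hloc₀ : ∀ a : A₀, res₀ a ≠ 0 → IsUnit a := by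
    intro a ha
    have hu : IsUnit (a : A) := hloc a ⟨res₀ a, ha, (hres₀ι a).symm⟩
    obtain ⟨v, hv⟩ := hu
    have hc : IsUnit (res₀ a) := isUnit_iff_ne_zero.2 ha
    obtain ⟨c, hc⟩ := hc
    have hinv : res (↑v⁻¹ : A) = ι5 ↑c⁻¹ := by
      have h1 : res (↑v⁻¹ : A) * res a = 1 := by rw [← map_mul, ← hv, Units.inv_mul, map_one]
      have h2 : ι5 ↑c⁻¹ * res a = 1 := by rw [← hres₀ι, ← hc, ← map_mul, Units.inv_mul, map_one]
      calc res (↑v⁻¹ : A) = res (↑v⁻¹ : A) * (ι5 ↑c⁻¹ * res a) := by rw [h2, mul_one]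
        _ = ι5 ↑c⁻¹ * (res (↑v⁻¹ : A) * res a) := by ring
        _ = ι5 ↑c⁻¹ := by rw [h1, mul_one]
    have hmem : (↑v⁻¹ : A) ∈ A₀ := (hA₀mem _).2 ⟨_, hinv.symm⟩
    refine ⟨⟨a, ⟨↑v⁻¹, hmem⟩, Subtype.ext ?_, Subtype.ext ?_⟩, rfl⟩
    · show (a : A) * ↑v⁻¹ = 1; rw [← hv, Units.mul_inv]
    · show ↑v⁻¹ * (a : A) = 1; rw [← hv, Units.inv_mul]
  -- the subgroup `H' = H ∩ res⁻¹(GL₂(𝔽₅))`, pulled back to `GL₂(A₀)`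
  set sub := Matrix.GeneralLinearGroup.map (n := Fin 2) A₀.subtype with hsub
  set H' : Subgroup (GL (Fin 2) A) := H ⊓ (ιk.range).comap ρ with hH'
  set H₀ : Subgroup (GL (Fin 2) A₀) := H'.comap sub with hH₀
  have hsubval : ∀ x : GL (Fin 2) A₀, (sub x).val = (x.val).map A₀.subtype := fun x => rfl
  have hres₀' : ∀ q : GL (Fin 2) (ZMod 5), ∃ h ∈ H₀, Matrix.GeneralLinearGroup.map res₀ h = q := by
    intro q
    obtain ⟨h, hh, hq⟩ := hres q
    have hent : ∀ i j, h.val i j ∈ A₀ := by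
      intro i j
      have e1 := congrArg (fun x : GL (Fin 2) k => x.val i j) hq
      simp only [hρ, Matrix.GeneralLinearGroup.map_apply] at e1
      exact (hA₀mem _).2 ⟨_, e1.symm⟩
    have hq' : ρ h⁻¹ = ιk q⁻¹ := by rw [map_inv, map_inv, hq]
    have hent' : ∀ i j, (h⁻¹).val i j ∈ A₀ := by
      intro i j
      have e1 := congrArg (fun x : GL (Fin 2) k => x.val i j) hq'
      simp only [hρ, hιk, Matrix.GeneralLinearGroup.map_apply] at e1
      exact (hA₀mem _).2 ⟨_, e1.symm⟩
    let M : Matrix (Fin 2) (Fin 2) A₀ := Matrix.of fun i j => ⟨h.val i j, hent i j⟩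
    let M' : Matrix (Fin 2) (Fin 2) A₀ := Matrix.of fun i j => ⟨(h⁻¹).val i j, hent' i j⟩
    have hM : M.map A₀.subtype = h.val := by ext i j; rfl
    have hM' : M'.map A₀.subtype = (h⁻¹).val := by ext i j; rfl
    have hinj : Function.Injective (fun X : Matrix (Fin 2) (Fin 2) A₀ => X.map A₀.subtype) :=
      Matrix.map_injective Subtype.val_injective
    have hMM' : M * M' = 1 := by
      apply hinj
      show (M * M').map A₀.subtype = (1 : Matrix (Fin 2) (Fin 2) A₀).map A₀.subtype
      rw [Matrix.map_mul, hM, hM', ← Units.val_mul, mul_inv_cancel, Units.val_one,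
        Matrix.map_one A₀.subtype (map_zero _) (map_one _)]
    have hM'M : M' * M = 1 := by
      apply hinj
      show (M' * M).map A₀.subtype = (1 : Matrix (Fin 2) (Fin 2) A₀).map A₀.subtype
      rw [Matrix.map_mul, hM', hM, ← Units.val_mul, inv_mul_cancel, Units.val_one,
        Matrix.map_one A₀.subtype (map_zero _) (map_one _)]
    let h₀ : GL (Fin 2) A₀ := ⟨M, M', hMM', hM'M⟩
    have hsubh₀ : sub h₀ = h := Units.ext hM
    refine ⟨h₀, ?_, ?_⟩
    · rw [hH₀, Subgroup.mem_comap, hsubh₀, hH', Subgroup.mem_inf, Subgroup.mem_comap]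
      exact ⟨hh, ⟨q, hq.symm⟩⟩
    · apply Units.ext; ext i j
      rw [Matrix.GeneralLinearGroup.map_apply]
      apply hι5inj
      rw [hres₀ι]
      have e1 := congrArg (fun x : GL (Fin 2) k => x.val i j) hq
      simp only [hρ, hιk, Matrix.GeneralLinearGroup.map_apply] at e1
      exact e1
  obtain ⟨u₀, hu₀, hu₀mem⟩ := exists_conj_smu_le_of_residual_GL2 A₀ res₀ hloc₀ m H₀ hres₀'
  refine ⟨sub u₀, ?_, fun g hg => ?_⟩
  · apply Units.ext; ext i j
    rw [Matrix.GeneralLinearGroup.map_apply, hsubval, Matrix.map_apply, Subring.coe_subtype, ← hres₀ι,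
      ← Matrix.GeneralLinearGroup.map_apply (f := res₀), hu₀, Units.val_one, Units.val_one, Matrix.one_apply,
      Matrix.one_apply]
    split_ifs <;> simp
  · have h1 := hu₀mem g hg
    rw [hH₀, Subgroup.mem_comap, map_mul, map_mul, map_inv] at h1
    have hι : sub (Matrix.GeneralLinearGroup.map (ZMod.castHom (dvd_refl (5 ^ (m + 1))) A₀) g) = ιA g := by
      have hc : A₀.subtype.comp (ZMod.castHom (dvd_refl (5 ^ (m + 1))) A₀) =
          ZMod.castHom (dvd_refl (5 ^ (m + 1))) A := Subsingleton.elim _ _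
      have h : Matrix.GeneralLinearGroup.map (n := Fin 2)
          (A₀.subtype.comp (ZMod.castHom (dvd_refl (5 ^ (m + 1))) A₀)) g = ιA g := by rw [hc]
      rw [Matrix.GeneralLinearGroup.map_comp] at h
      exact h
    rw [hι] at h1
    exact (Subgroup.mem_inf.1 h1).1

/-- **Corollary (`f ≥ 1`): a conjugate of `SL₂(ℤ/5^{m+1})` inside `H`.** Under the hypotheses of
`exists_conj_smu_le_of_residual_GL2_charP`, `u · SL₂(ℤ/5^{m+1}) · u⁻¹ ⊆ H` for some `u` with `res(u) = 1` —
Kato's (12.5.2) / Skinner–Urban's lattice shape at every finite level `𝒪_𝔭/𝔭ⁿ` of EVERY Δ1 ring (any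
`e`, `f`), from the residual image (the image of) `GL₂(𝔽₅)` alone. -/
theorem exists_conj_SL2_le_of_residual_GL2_charP (A : Type u) [CommRing A] [Finite A]
    (k : Type v) [CommRing k] [CharP k 5] (res : A →+* k)
    (hloc : ∀ a : A, (∃ c : ZMod 5, c ≠ 0 ∧ res a = ZMod.castHom (dvd_refl 5) k c) → IsUnit a)
    (m : ℕ) [CharP A (5 ^ (m + 1))] (H : Subgroup (GL (Fin 2) A))
    (hres : ∀ q : GL (Fin 2) (ZMod 5), ∃ h ∈ H, Matrix.GeneralLinearGroup.map res h =
      Matrix.GeneralLinearGroup.map (ZMod.castHom (dvd_refl 5) k) q) :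
    ∃ u : GL (Fin 2) A, Matrix.GeneralLinearGroup.map res u = 1 ∧
      ∀ g : Matrix.SpecialLinearGroup (Fin 2) (ZMod (5 ^ (m + 1))),
        u * Matrix.GeneralLinearGroup.map (ZMod.castHom (dvd_refl (5 ^ (m + 1))) A)
          (Matrix.SpecialLinearGroup.toGL g) * u⁻¹ ∈ H := by
  obtain ⟨u, hu1, hu⟩ := exists_conj_smu_le_of_residual_GL2_charP A k res hloc m H hres
  refine ⟨u, hu1, fun g => hu _ ?_⟩
  rw [Matrix.SpecialLinearGroup.coe_GL_coe_matrix, g.prop, one_pow]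

end residuefield

end Summit.BirchSwinnertonDyer.BirchSwinnertonDyer.Theorems.GL2F5AdjointBricks
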